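/-
Copyright (c) 2026 the pub-hodgecm-mathlib formalisation cell (harness21).  Prover seat hodgecm-mathlib-F0P2-p11 (g0) (L1; KIND 1 of #41, organ K1-a «singular big-cell term», brick
(R1-α′-1) of the «cells cut» ★ p861869), Track B «K2-LIT» ∕ hLiu418 #184♮, ROAD Φ: COORDINATES ON THE CORNER COMPLEMENT `N_χ(𝔸) = {u ∈ N_Δ(𝔸) : (X_u)₁₁ = 0}` — the `(0,0)`-corner
line and the off-diagonal plane, from ONE chart.  THEOREMS ONLY.
-/
import Summits.HodgeConjecture.HodgeConjecture.Theorems.K2LiuUnipDeltaCornerCoordinates   -- ★ FILE B p860079: frame∕corner API (`toBlocks₁₂_eq_of_frame`, `skew_single`, `im`, …)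
import HarnessLib

/-!
# Crux `HLiu418`, ROAD Φ, KIND 1 organ K1-a, brick (R1-α′-1): the two one-parameter families `n₀₀ : 𝔸_{L⁺} → N_Δ(𝔸)` (corner `(0,0)`) and `n₀₁ : 𝔸_L → N_Δ(𝔸)` (off-diagonal
# plane) of the rank-`2` doubled datum, from ONE chart, and the factorisation `u = n₀₀(im (X_u)₀₀) · n₀₁((X_u)₀₁)` of every `u ∈ N_Δ(𝔸)` with `(X_u)₁₁ = 0`

Cell `hodgecm-mathlib`, crux item hLiu418 = `stmt-HodgeConjecture-24832` (helper lane, count-neutral); squad K2 ∕ K2Liu, LEAD F0P6-plan (g14) (BATCH #52 (8): KIND 1 = F0P2-p11);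
prover F0P2-p11 (g0).  THEOREMS ONLY (no `def`, no `instance`, no notation, no named-fact hypothesis, no `sorry`).

WHY.  The singular big-cell term of a rank-one Fourier coefficient (★ p861405 `exists_whittakerDelta_rankOne_eq_corner_integral`) is a corner-line integral of the
`Z = N_χ(𝔸)`-PERIOD `∫_Z f(w_Δ·z·g) dμZ(z)`, `Z = {u ∈ N_Δ(𝔸) : w₀ u w₀⁻¹ ∈ P_Δ} = {u : (X_u)₁₁ = 0}` (★ α2d-2 `stabilizer_reflStd_iff`).  To read that period as
«`X₀₀`-intertwining of the inner section, then `X₀₁`-intertwining» (K1-a's road: GL₂ Gindikin–Karpelevich × carrier-«A» Whittaker) one needs COORDINATES on `Z`: this file builds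
them from ★ `K2LiuUnipotentChart.exists_unipChart` (ONE chart `Φ`, so that products of coordinates are computed by `Φ(X + Y) = Φ X · Φ Y`), exactly as ★ FILE B
`exists_cornerSubgroup` built the `(1,1)`-corner line:
* §1 `offDiag_skew` — with `T = diag(t₀, t₁)` (★ `exists_gramRA_eq_diagonal`), the matrix `Y(x) = !![0, x; κ x, 0]`, **`κ x := −(σ x · t₀ · t₁⁻¹)`**, is `T`-skew
  (`T·Y + (σY)ᵀ·T = 0`); `offDiag_entry_of_skew` — conversely a `T`-skew `X` has `X₁₀ = κ(X₀₁)`.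
* §2 **`exists_planeCoordinates`** — `∃ n₀₀ n₀₁`: `n₀₀ : 𝔸_{L⁺} → H(𝔸)` continuous additive with values in `N_Δ(𝔸)`, frame `X = single 0 0 ((y ⊗ 1)δ)`, rational on `L⁺`;
  `n₀₁ : 𝔸_L → H(𝔸)` continuous additive with values in `N_Δ(𝔸)`, frame `X = Y(x) = !![0, x; κ x, 0]`, rational on `L`; `n₀₀ y` and `n₀₁ x` COMMUTE (`N_Δ(𝔸)` is commutative); and the
  FACTORISATION: every `u ∈ N_Δ(𝔸)` with `(X_u)₁₁ = 0` is `n₀₀ (im (X_u)₀₀) · n₀₁ ((X_u)₀₁)`, every `u` with `(X_u)₁₁ = 0 = (X_u)₀₀` is `n₀₁ ((X_u)₀₁)`, and every `u` with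
  `X_u = single 0 0 (X_u)₀₀` is `n₀₀ (im (X_u)₀₀)`.
References: [GelbartPiatetskishapiroRallis1987] Part A §1 (the Siegel unipotent radical as hermitian matrices); [MoeglinWaldspurger1995] II.1.7; [KudlaRallis1994] §2;
[CasselsFrohlichANT1967] Ch. II §10 (the quadratic base change `𝔸_L = 𝔸_{L⁺} ⊕ 𝔸_{L⁺}δ`).
HONEST LABEL.  Count-neutral helper; `HC_CM` is proved only modulo the 7 printed citations (2 remaining named inputs: hLiu418 = `stmt-HodgeConjecture-24832`,
h413 = `stmt-HodgeConjecture-24833`) until rung 0 closes.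
-/

set_option autoImplicit false
set_option linter.dupNamespace false -- the mandated namespace repeats `HodgeConjecture.HodgeConjecture`

noncomputable section

open scoped Matrix
open NumberField IsDedekindDomain
open Literature.NumberTheory.Automorphic Literature.NumberTheory.Automorphic.UnitaryGroup Literature.NumberTheory.GaloisRepresentations
open Literature.NumberTheory.GelbartRogawski1991 Literature.NumberTheory.GelbartRogawski1991.GRConstruction
open Literature.NumberTheory.K2Lit.SiegelDoubled
open UnitaryDualPair
open Literature.NumberTheory.Automorphic.DoubledUnitary.RankOneReduction (mem_range_toAdelic_iff)
open Summit.HodgeConjecture.HodgeConjecture.Cruxes.HLiu418.K2LiuUnipotentChart (exists_unipChart skew_of_mem_unipDelta)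
open Summit.HodgeConjecture.HodgeConjecture.Cruxes.HLiu418.K2LiuUnipDeltaCornerCoordinates
open Summit.HodgeConjecture.HodgeConjecture.Cruxes.HLiu418.K2LiuSiegelDoubledLeviMatrix (conjAdele_conjAdele')

namespace Summit.HodgeConjecture.HodgeConjecture.Cruxes.HLiu418.K2LiuUnipDeltaPlaneCoordinates

variable (L : Type) [Field L] [NumberField L] [IsCMField L]

/-! ## §1 The off-diagonal skew matrices `Y(x) = !![0, x; κ x, 0]` -/

section Skew

/-- `σ` fixes `L⁺ ⊂ 𝔸_L`. [cite: CasselsFrohlichANT1967, Ch. VII §1.1] -/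
theorem conjAdele_algebraMap_fp (a : Fp L) :
    conjAdele (Fp L) L (IsCMField.complexConj L) (((algebraMap L (AdeleRing (𝓞 L) L)).comp (algebraMap (Fp L) L)) a) =
      ((algebraMap L (AdeleRing (𝓞 L) L)).comp (algebraMap (Fp L) L)) a := by
  rw [RingHom.comp_apply, ← algebraMap_conj (Fp L) L (IsCMField.complexConj L)]
  congr 1
  exact (IsCMField.complexConj L).commutes a

variable {T₀ T₁ T₁' : AdeleRing (𝓞 L) L}

/-- **THE OFF-DIAGONAL SKEW MATRICES**: for `T = diag(T₀, T₁)` with `σ T_i = T_i` and `T₁'·T₁ = 1`, `Y(x) := single 0 1 x + single 1 0 (−(σ x · T₀ · T₁'))` satisfies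
`T·Y + (σY)ᵀ·T = 0`, `Y = !![0, x; −(σ x · T₀ · T₁'), 0]`. [cite: GelbartPiatetskishapiroRallis1987, Part A §1] -/
theorem offDiag_skew (hT₀ : conjAdele (Fp L) L (IsCMField.complexConj L) T₀ = T₀) (hT₁' : conjAdele (Fp L) L (IsCMField.complexConj L) T₁' = T₁')
    (hinv : T₁' * T₁ = 1) (x : AdeleRing (𝓞 L) L) :
    Matrix.diagonal ![T₀, T₁] * !![0, x; -(conjAdele (Fp L) L (IsCMField.complexConj L) x * T₀ * T₁'), 0] +
      ((!![0, x; -(conjAdele (Fp L) L (IsCMField.complexConj L) x * T₀ * T₁'), 0]).map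
          (conjAdele (Fp L) L (IsCMField.complexConj L)))ᵀ * Matrix.diagonal ![T₀, T₁] = 0 := by
  have hσ : conjAdele (Fp L) L (IsCMField.complexConj L) (-(conjAdele (Fp L) L (IsCMField.complexConj L) x * T₀ * T₁')) = -(x * T₀ * T₁') := by
    rw [map_neg, map_mul, map_mul, conjAdele_conjAdele' L, hT₀, hT₁']
  ext i j
  fin_cases i <;> fin_cases j <;>
    simp only [Matrix.add_apply, Matrix.diagonal_mul, Matrix.mul_diagonal, Matrix.transpose_apply, Matrix.map_apply, Matrix.of_apply,
      Matrix.cons_val', Matrix.cons_val_zero, Matrix.cons_val_one, Matrix.empty_val', Matrix.zero_apply, map_zero, mul_zero, zero_mul, add_zero, hσ,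
      Fin.zero_eta, Fin.mk_one]
  · linear_combination (-(x * T₀)) * hinv
  · linear_combination (-(conjAdele (Fp L) L (IsCMField.complexConj L) x * T₀)) * hinv

/-- **conversely, the `(1,0)` entry of a `T`-skew matrix is `κ` of its `(0,1)` entry**: `T·X + (σX)ᵀ·T = 0 ⇒ X₁₀ = −(σ X₀₁ · T₀ · T₁')`.
[cite: GelbartPiatetskishapiroRallis1987, Part A §1] -/
theorem offDiag_entry_of_skew (hinv : T₁' * T₁ = 1) {X : Matrix (Fin 2) (Fin 2) (AdeleRing (𝓞 L) L)}
    (hX : Matrix.diagonal ![T₀, T₁] * X + (X.map (conjAdele (Fp L) L (IsCMField.complexConj L)))ᵀ * Matrix.diagonal ![T₀, T₁] = 0) :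
    X 1 0 = -(conjAdele (Fp L) L (IsCMField.complexConj L) (X 0 1) * T₀ * T₁') := by
  have h10 := congrFun (congrFun hX 1) 0
  simp only [Matrix.add_apply, Matrix.diagonal_mul, Matrix.mul_diagonal, Matrix.transpose_apply, Matrix.map_apply,
    Matrix.cons_val_zero, Matrix.cons_val_one, Matrix.zero_apply] at h10
  -- `h10 : T₁ * X 1 0 + σ(X 0 1) * T₀ = 0`
  linear_combination T₁' * h10 - X 1 0 * hinv

end Skew

/-! ## §2 The coordinates `n₀₀`, `n₀₁` and the factorisation of `N_χ(𝔸)` -/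

section Coordinates

variable {N M : ℕ} (e : Fin N × Fin M ≃ Fin 2)
  (dV : Fin N → L) (hdV : ∀ i, IsCMField.complexConj L (dV i) = dV i)
  (dW : Fin M → L) (hdW : ∀ i, IsCMField.complexConj L (dW i) = dW i)

/-- **COORDINATES ON THE CORNER COMPLEMENT.**  For the rank-`2` doubled datum (`dV i, dW j ≠ 0`) there are `n₀₀ : 𝔸_{L⁺} → H(𝔸)` and `n₀₁ : 𝔸_L → H(𝔸)`, continuous and additive,
with values in `N_Δ(𝔸)`, frame coordinates `X_{n₀₀ y} = single 0 0 ((y ⊗ 1)δ)` and `X_{n₀₁ x} = !![0, x; κ x, 0]` for some `κ`, rational on `L⁺` resp. `L`,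
commuting, such that every `u ∈ N_Δ(𝔸)` with `(X_u)₁₁ = 0` factors as `u = n₀₀ (im (X_u)₀₀) · n₀₁ ((X_u)₀₁)` (and the two one-coordinate special cases).
[cite: GelbartPiatetskishapiroRallis1987, Part A §1] [cite: MoeglinWaldspurger1995, II.1.7] [cite: KudlaRallis1994, §2] -/
theorem exists_planeCoordinates (hdV0 : ∀ i, dV i ≠ 0) (hdW0 : ∀ i, dW i ≠ 0) :
    ∃ (n₀₀ : AdeleRing (𝓞 (Fp L)) (Fp L) → HA L e dV hdV dW hdW) (n₀₁ : AdeleRing (𝓞 L) L → HA L e dV hdV dW hdW)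
      (κ : AdeleRing (𝓞 L) L → AdeleRing (𝓞 L) L),
      Continuous n₀₀ ∧ (∀ s t, n₀₀ (s + t) = n₀₀ s * n₀₀ t) ∧ n₀₀ 0 = 1 ∧ (∀ y, n₀₀ y ∈ unipDelta L e dV hdV dW hdW) ∧
      (∀ y, (blk L e dV hdV dW hdW (n₀₀ y)).toBlocks₁₂ =
        Matrix.single (0 : Fin 2) (0 : Fin 2) (AdeleRing.baseChange (Fp L) L y * algebraMap L (AdeleRing (𝓞 L) L) (imagUnit L))) ∧
      (∀ y : Fp L, n₀₀ (algebraMap (Fp L) (AdeleRing (𝓞 (Fp L)) (Fp L)) y) ∈ ratH L e dV hdV dW hdW) ∧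
      Continuous n₀₁ ∧ (∀ x x', n₀₁ (x + x') = n₀₁ x * n₀₁ x') ∧ n₀₁ 0 = 1 ∧ (∀ x, n₀₁ x ∈ unipDelta L e dV hdV dW hdW) ∧
      (∀ x, (blk L e dV hdV dW hdW (n₀₁ x)).toBlocks₁₂ = !![0, x; κ x, 0]) ∧
      (∀ x : L, n₀₁ (algebraMap L (AdeleRing (𝓞 L) L) x) ∈ ratH L e dV hdV dW hdW) ∧
      (∀ y x, n₀₀ y * n₀₁ x = n₀₁ x * n₀₀ y) ∧
      (∀ u : HA L e dV hdV dW hdW, u ∈ unipDelta L e dV hdV dW hdW → (blk L e dV hdV dW hdW u).toBlocks₁₂ 1 1 = 0 →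
        n₀₀ ((quadraticAdeleEquiv (Fp L) L (IsCMField.complexConj L) (complexConj_imagUnit L) (imagUnit_ne_zero L)).symm
            ((blk L e dV hdV dW hdW u).toBlocks₁₂ 0 0)).2 * n₀₁ ((blk L e dV hdV dW hdW u).toBlocks₁₂ 0 1) = u) ∧
      (∀ u : HA L e dV hdV dW hdW, u ∈ unipDelta L e dV hdV dW hdW → (blk L e dV hdV dW hdW u).toBlocks₁₂ 1 1 = 0 →
        (blk L e dV hdV dW hdW u).toBlocks₁₂ 0 0 = 0 → n₀₁ ((blk L e dV hdV dW hdW u).toBlocks₁₂ 0 1) = u) ∧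
      (∀ u : HA L e dV hdV dW hdW, u ∈ unipDelta L e dV hdV dW hdW →
        (blk L e dV hdV dW hdW u).toBlocks₁₂ = Matrix.single (0 : Fin 2) (0 : Fin 2) ((blk L e dV hdV dW hdW u).toBlocks₁₂ 0 0) →
        n₀₀ ((quadraticAdeleEquiv (Fp L) L (IsCMField.complexConj L) (complexConj_imagUnit L) (imagUnit_ne_zero L)).symm
            ((blk L e dV hdV dW hdW u).toBlocks₁₂ 0 0)).2 = u) := by
  obtain ⟨Φ, hΦc, hΦadd, hΦmem, hΦsurj, hΦrat⟩ := exists_unipChart L e dV hdV dW hdW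
  -- the Gram matrix over `𝔸` is `diag(T₀, T₁)` with `T_i ∈ L⁺`, `T₁` a unit
  obtain ⟨t, ht0, hT⟩ := exists_gramRA_eq_diagonal L e dV hdV dW hdW hdV0 hdW0
  set ι₀ : Fp L →+* AdeleRing (𝓞 L) L := (algebraMap L (AdeleRing (𝓞 L) L)).comp (algebraMap (Fp L) L) with hι₀
  set σ := conjAdele (Fp L) L (IsCMField.complexConj L) with hσdef
  have hTdiag : (gramR L e dV hdV dW hdW).map ι₀ = Matrix.diagonal ![ι₀ (t 0), ι₀ (t 1)] := by
    rw [hT]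
    congr 1
    funext i
    fin_cases i <;> rfl
  have hT₀σ : σ (ι₀ (t 0)) = ι₀ (t 0) := conjAdele_algebraMap_fp L (t 0)
  have hT₁'σ : σ (ι₀ (t 1)⁻¹) = ι₀ (t 1)⁻¹ := conjAdele_algebraMap_fp L (t 1)⁻¹
  have hinv : ι₀ (t 1)⁻¹ * ι₀ (t 1) = 1 := by rw [← map_mul, inv_mul_cancel₀ (ht0 1), map_one]
  -- the coordinate matrices
  let κ : AdeleRing (𝓞 L) L → AdeleRing (𝓞 L) L := fun x => -(σ x * ι₀ (t 0) * ι₀ (t 1)⁻¹)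
  let xδ : AdeleRing (𝓞 (Fp L)) (Fp L) → AdeleRing (𝓞 L) L := fun y => AdeleRing.baseChange (Fp L) L y * algebraMap L (AdeleRing (𝓞 L) L) (imagUnit L)
  let X₀ : AdeleRing (𝓞 (Fp L)) (Fp L) → Matrix (Fin 2) (Fin 2) (AdeleRing (𝓞 L) L) := fun y => Matrix.single 0 0 (xδ y)
  let Y : AdeleRing (𝓞 L) L → Matrix (Fin 2) (Fin 2) (AdeleRing (𝓞 L) L) := fun x => !![0, x; κ x, 0]
  have hκadd : ∀ x x', κ (x + x') = κ x + κ x' := fun x x' => by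
    show -(σ (x + x') * _ * _) = -(σ x * _ * _) + -(σ x' * _ * _)
    rw [map_add]; ring
  have hκ0 : κ 0 = 0 := by show -(σ 0 * _ * _) = 0; rw [map_zero, zero_mul, zero_mul, neg_zero]
  have hX₀skew : ∀ y, (gramR L e dV hdV dW hdW).map ι₀ * X₀ y + ((X₀ y).map σ)ᵀ * (gramR L e dV hdV dW hdW).map ι₀ = 0 :=
    fun y => skew_single L e dV hdV dW hdW hdV0 hdW0 0 (conjAdele_baseChange_mul_delta L y)
  have hYskew : ∀ x, (gramR L e dV hdV dW hdW).map ι₀ * Y x + ((Y x).map σ)ᵀ * (gramR L e dV hdV dW hdW).map ι₀ = 0 := fun x => by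
    rw [hTdiag]
    exact offDiag_skew L hT₀σ hT₁'σ hinv x
  have hX₀add : ∀ s s', X₀ (s + s') = X₀ s + X₀ s' := fun s s' => by
    simp only [X₀, xδ, map_add, add_mul, Matrix.single_add]
  have hYadd : ∀ x x', Y (x + x') = Y x + Y x' := fun x x' => by
    ext i j
    fin_cases i <;> fin_cases j <;> simp [Y, hκadd]
  -- the maps
  let n₀₀ : AdeleRing (𝓞 (Fp L)) (Fp L) → HA L e dV hdV dW hdW := fun y => ⟨Φ (X₀ y), (hΦmem (X₀ y) (hX₀skew y)).fst⟩
  let n₀₁ : AdeleRing (𝓞 L) L → HA L e dV hdV dW hdW := fun x => ⟨Φ (Y x), (hΦmem (Y x) (hYskew x)).fst⟩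
  have hn₀₀coe : ∀ y, ((n₀₀ y : HA L e dV hdV dW hdW) : GL (Fin (2 + 2)) (AdeleRing (𝓞 L) L)) = Φ (X₀ y) := fun _ => rfl
  have hn₀₁coe : ∀ x, ((n₀₁ x : HA L e dV hdV dW hdW) : GL (Fin (2 + 2)) (AdeleRing (𝓞 L) L)) = Φ (Y x) := fun _ => rfl
  have hmem₀₀ : ∀ y, n₀₀ y ∈ unipDelta L e dV hdV dW hdW := fun y => (hΦmem (X₀ y) (hX₀skew y)).snd.1
  have hmem₀₁ : ∀ x, n₀₁ x ∈ unipDelta L e dV hdV dW hdW := fun x => (hΦmem (Y x) (hYskew x)).snd.1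
  have hframe₀₀ : ∀ y, (blk L e dV hdV dW hdW (n₀₀ y)).toBlocks₁₂ = X₀ y := fun y =>
    toBlocks₁₂_eq_of_frame L e dV hdV dW hdW (n₀₀ y) (hΦmem (X₀ y) (hX₀skew y)).snd.2
  have hframe₀₁ : ∀ x, (blk L e dV hdV dW hdW (n₀₁ x)).toBlocks₁₂ = Y x := fun x =>
    toBlocks₁₂_eq_of_frame L e dV hdV dW hdW (n₀₁ x) (hΦmem (Y x) (hYskew x)).snd.2
  have hadd₀₀ : ∀ s s', n₀₀ (s + s') = n₀₀ s * n₀₀ s' := fun s s' => Subtype.ext (by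
    show Φ (X₀ (s + s')) = Φ (X₀ s) * Φ (X₀ s')
    rw [hX₀add, hΦadd])
  have hadd₀₁ : ∀ x x', n₀₁ (x + x') = n₀₁ x * n₀₁ x' := fun x x' => Subtype.ext (by
    show Φ (Y (x + x')) = Φ (Y x) * Φ (Y x')
    rw [hYadd, hΦadd])
  have hzero₀₀ : n₀₀ 0 = 1 := by
    have h := hadd₀₀ 0 0
    rw [add_zero] at h
    exact mul_eq_left.1 h.symm
  have hzero₀₁ : n₀₁ 0 = 1 := by
    have h := hadd₀₁ 0 0
    rw [add_zero] at h
    exact mul_eq_left.1 h.symm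
  have hcomm : ∀ y x, n₀₀ y * n₀₁ x = n₀₁ x * n₀₀ y := fun y x =>
    mul_comm_of_mem_unipDelta L e dV hdV dW hdW (hmem₀₀ y) (hmem₀₁ x)
  -- continuity of the coordinate matrices
  have hX₀c : Continuous X₀ := by
    refine continuous_matrix fun i j => ?_
    simp only [X₀, Matrix.single, Matrix.of_apply]
    split_ifs
    · exact continuous_baseChange_mul_delta L
    · exact continuous_const
  have hκc : Continuous κ := ((continuous_conjAdele (Fp L) L (IsCMField.complexConj L)).mul continuous_const).mul continuous_const |>.neg
  have hYc : Continuous Y := by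
    refine continuous_matrix fun i j => ?_
    fin_cases i <;> fin_cases j
    · simpa [Y] using continuous_const
    · simpa [Y] using continuous_id'
    · simpa [Y] using hκc
    · simpa [Y] using continuous_const
  -- the factorisation of a skew coordinate with vanishing corner `(1,1)`
  have hdecomp : ∀ u : HA L e dV hdV dW hdW, u ∈ unipDelta L e dV hdV dW hdW → (blk L e dV hdV dW hdW u).toBlocks₁₂ 1 1 = 0 →
      (blk L e dV hdV dW hdW u).toBlocks₁₂ =
        Matrix.single 0 0 ((blk L e dV hdV dW hdW u).toBlocks₁₂ 0 0) + Y ((blk L e dV hdV dW hdW u).toBlocks₁₂ 0 1) := by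
    intro u hu h11
    have hsk := skew_of_mem_unipDelta L e dV hdV dW hdW hu
    rw [hTdiag] at hsk
    have h10 := offDiag_entry_of_skew L hinv hsk
    ext i j
    fin_cases i <;> fin_cases j
    · simp [Y]
    · simp [Y]
    · simpa [Y, κ, hσdef] using h10
    · simpa [Y] using h11
  refine ⟨n₀₀, n₀₁, κ, ?_, hadd₀₀, hzero₀₀, hmem₀₀, hframe₀₀, fun y => ?_, ?_, hadd₀₁, hzero₀₁, hmem₀₁, hframe₀₁, fun x => ?_, hcomm,
    fun u hu h11 => ?_, fun u hu h11 h00 => ?_, fun u hu hX => ?_⟩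
  · exact Continuous.subtype_mk (hΦc.comp hX₀c) _
  · -- rationality of `n₀₀` on `L⁺`
    refine (mem_range_toAdelic_iff (Fp L) L (IsCMField.complexConj L) (hermD L e dV hdV dW hdW) _).2 ?_
    have hXrat : X₀ (algebraMap (Fp L) (AdeleRing (𝓞 (Fp L)) (Fp L)) y) =
        (Matrix.single (0 : Fin 2) (0 : Fin 2) (algebraMap (Fp L) L y * imagUnit L)).map (algebraMap L (AdeleRing (𝓞 L) L)) := by
      rw [Matrix.map_single, map_mul]
      simp only [X₀, xδ, AdeleRing.baseChange_algebraMap]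
    rw [hn₀₀coe, hXrat]
    exact hΦrat _
  · exact Continuous.subtype_mk (hΦc.comp hYc) _
  · -- rationality of `n₀₁` on `L`
    refine (mem_range_toAdelic_iff (Fp L) L (IsCMField.complexConj L) (hermD L e dV hdV dW hdW) _).2 ?_
    have hκrat : κ (algebraMap L (AdeleRing (𝓞 L) L) x) =
        algebraMap L (AdeleRing (𝓞 L) L) (-(IsCMField.complexConj L x * algebraMap (Fp L) L (t 0) * algebraMap (Fp L) L (t 1)⁻¹)) := by
      show -(σ (algebraMap L (AdeleRing (𝓞 L) L) x) * ι₀ (t 0) * ι₀ (t 1)⁻¹) = _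
      rw [map_neg, map_mul, map_mul, hσdef, ← algebraMap_conj (Fp L) L (IsCMField.complexConj L)]
      rfl
    have hYrat : Y (algebraMap L (AdeleRing (𝓞 L) L) x) =
        (!![0, x; -(IsCMField.complexConj L x * algebraMap (Fp L) L (t 0) * algebraMap (Fp L) L (t 1)⁻¹), 0]).map
          (algebraMap L (AdeleRing (𝓞 L) L)) := by
      ext i j
      fin_cases i <;> fin_cases j <;> simp [Y, hκrat]
    rw [hn₀₁coe, hYrat]
    exact hΦrat _
  · -- the factorisation `u = n₀₀ (im X₀₀) · n₀₁ X₀₁`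
    have hanti := conjAdele_toBlocks₁₂_diag_eq_neg L e dV hdV dW hdW hdV0 hdW0 hu 0
    have hxim : xδ (((quadraticAdeleEquiv (Fp L) L (IsCMField.complexConj L) (complexConj_imagUnit L) (imagUnit_ne_zero L)).symm
        ((blk L e dV hdV dW hdW u).toBlocks₁₂ 0 0)).2) = (blk L e dV hdV dW hdW u).toBlocks₁₂ 0 0 := baseChange_im_mul_delta L hanti
    refine Subtype.ext ?_
    rw [Subgroup.coe_mul]
    show Φ (Matrix.single 0 0 (xδ _)) * Φ (Y _) = _
    rw [hxim, ← hΦadd, ← hdecomp u hu h11]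
    exact hΦsurj u hu
  · -- the one-coordinate case `X₀₀ = X₁₁ = 0`
    refine Subtype.ext ?_
    show Φ (Y _) = _
    have h := hdecomp u hu h11
    rw [h00, Matrix.single_zero, zero_add] at h
    rw [← h]
    exact hΦsurj u hu
  · -- the one-coordinate case `X = single 0 0 X₀₀`
    have hanti := conjAdele_toBlocks₁₂_diag_eq_neg L e dV hdV dW hdW hdV0 hdW0 hu 0
    have hxim : xδ (((quadraticAdeleEquiv (Fp L) L (IsCMField.complexConj L) (complexConj_imagUnit L) (imagUnit_ne_zero L)).symm
        ((blk L e dV hdV dW hdW u).toBlocks₁₂ 0 0)).2) = (blk L e dV hdV dW hdW u).toBlocks₁₂ 0 0 := baseChange_im_mul_delta L hanti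
    refine Subtype.ext ?_
    show Φ (Matrix.single 0 0 (xδ _)) = _
    rw [hxim, ← hX]
    exact hΦsurj u hu

end Coordinates

end Summit.HodgeConjecture.HodgeConjecture.Cruxes.HLiu418.K2LiuUnipDeltaPlaneCoordinates

end
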